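import Literature.NumberTheory.Automorphic.CongruenceSubgroupPropertySL2Lemma4
import Literature.NumberTheory.Automorphic.CongruenceSubgroupPropertySL2Lemma5
import HarnessLib

/-!
# Serre's congruence subgroup property for `SL₂(𝓞_F)` — proofs, XIII: Vaserstein's Lemma 2;
`E(I₁, I₂)` is normal in `G(I₁, I₂)`

Topic `Literature/NumberTheory/Automorphic`; namespace `Literature.NumberTheory.Automorphic.SL2Rel`.
Everything here is PROVED; no definitions.

**Vaserstein 1972, Lemma 2** (= Liehl 1981, (4)): *for every non-zero ideal `I` of `A = 𝓞 K` and
every `g ∈ SL₂(k)` there is a non-zero ideal `I' ⊆ I` with `A⁻¹ g A g⁻¹ ∈ E(I, I)` for all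
`A ∈ G(I', I')`* — `SL2Rel.exists_forall_relG_conj_mem`.  Proof as printed (p. 319): the `g` for
which Lemma 2 holds form a normal subgroup of `SL₂(k)` (by Lemma 4; `lemma2_mul/inv/conj`), a normal
subgroup of `SL₂(k)` not inside the centre is everything (`normal_le_center_or_eq_top`), and Lemma 2
holds for the non-central `g = diag(t, t⁻¹)`, `t` a unit of infinite order, with `I' = I`: by
Lemma 4, `A⁻¹ E(I'', I'') A ⊆ E(I, I)`; by Lemma 1, `B = AE ∈ G(I'', I'')`; by Lemma 5,
`g B g⁻¹ ∈ E(I'', I'') B E(I'', I'')`; hence `g A g⁻¹ ∈ E(I'', I'') A E(I, I) ⊆ A E(I, I)`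
(`conj_diagHom_mem_relE_of_mem_relG`).

**Corollary** (Vaserstein p. 314 = Liehl (5)): `E(I₁, I₂)` is a normal subgroup of `G(I₁, I₂)`
(`SL2Rel.conj_mem_relE_of_mem_relG`).

Hypotheses throughout: `K` has a real place and a unit of infinite order (both hold for a totally
real field of degree `≥ 2`).

## References

* [Vaserstein1972SL2] L. N. Vaserstein, Mat. Sb. 89 (131) (1972) 313–322, Lemma 2 and p. 314.
* [Liehl1981SL2Orders] B. Liehl, J. reine angew. Math. 323 (1981) 153–171, (4), (5).
-/

open Matrix MatrixGroups NumberField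

namespace Literature.NumberTheory.Automorphic

namespace SL2Rel

section NumberField

variable {K : Type} [Field K] [NumberField K]

/-- **The main step of Lemma 2** (Vaserstein p. 319, with `s = 1`): for `g = diag(t, t⁻¹)`, `t` a
unit, `I ≠ 0` and `A ∈ G(I, I)`: `A⁻¹ g A g⁻¹ ∈ E(I, I)`. [cite: Vaserstein1972SL2, Lemma 2 (proof)] -/
theorem conj_diagHom_mem_relE_of_mem_relG (hreal : ∃ w : InfinitePlace K, w.IsReal)
    (hunit : ∃ v : (𝓞 K)ˣ, ∀ n : ℕ, n ≠ 0 → v ^ n ≠ 1) (t : (𝓞 K)ˣ) {I : Ideal (𝓞 K)}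
    (hI : I ≠ ⊥) {A : SL(2, 𝓞 K)} (hA : A ∈ relG I I) :
    A⁻¹ * diagHom t * A * (diagHom t)⁻¹ ∈ relE I I := by
  obtain ⟨w, hw⟩ := id hreal
  set σ : K →+* ℝ := NumberField.InfinitePlace.embedding_of_isReal hw with hσ
  have hinj := map_injective (algebraMap (𝓞 K) K) (IsFractionRing.injective (𝓞 K) K)
  -- Lemma 4 for `A⁻¹`: `A⁻¹ E(I'', I'') A ⊆ E(I, I)`, and we may assume `I'' ⊆ I`
  obtain ⟨I'', hI'', h4⟩ := exists_conj_relE_le hreal hunit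
    (SpecialLinearGroup.map (algebraMap (𝓞 K) K) A⁻¹) hI
  set I₀ : Ideal (𝓞 K) := I'' * I with hI₀
  have hI₀0 : I₀ ≠ ⊥ := mul_ne_zero hI'' hI
  have hI₀I : I₀ ≤ I := Ideal.mul_le_left
  have h4' : ∀ M ∈ relE I₀ I₀, A⁻¹ * M * A ∈ relE I I := by
    intro M hM
    obtain ⟨E, hE, hEq⟩ := h4 M (relE_mono Ideal.mul_le_right Ideal.mul_le_right hM)
    rw [← map_inv, ← map_mul, ← map_mul, inv_inv] at hEq
    rwa [← hinj hEq]
  -- Lemma 1: `B = AE ∈ G(I₀, I₀)`; Lemma 5: `g B g⁻¹ = E₁ B E₂`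
  obtain ⟨E, hE, hB⟩ := exists_mul_relE_mem_relG hI₀0 hI₀I hA
  obtain ⟨E₁, hE₁, E₂, hE₂, h5⟩ := exists_diagHom_conj_eq σ t (A * E) hB.1 hB.2.1
  have key : A⁻¹ * diagHom t * A * (diagHom t)⁻¹ =
      (A⁻¹ * E₁ * A) * E * E₂ * (diagHom t * E⁻¹ * (diagHom t)⁻¹) := by
    calc A⁻¹ * diagHom t * A * (diagHom t)⁻¹
        = A⁻¹ * (diagHom t * (A * E) * (diagHom t)⁻¹) * (diagHom t * E⁻¹ * (diagHom t)⁻¹) := by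
          group
      _ = _ := by rw [h5]; group
  rw [key]
  exact mul_mem (mul_mem (mul_mem (h4' E₁ hE₁) hE) (relE_mono hI₀I hI₀I hE₂))
    (conj_diagHom_mem_relE t (inv_mem hE))

/-! Below, "Lemma 2 holds for `h`" (principal-congruence form) means: for every ideal `I ≠ 0`
there is an ideal `I' ≠ 0` with `A⁻¹ h A h⁻¹ ∈ E(I, I)` (inside `SL₂(K)`) for all `A ∈ Γ(I')`; we
spell this out in each statement. -/

omit [NumberField K] in
/-- Lemma 2 holds for `1`. [folklore] -/
theorem lemma2_one :
    ∀ I : Ideal (𝓞 K), I ≠ ⊥ → ∃ I' : Ideal (𝓞 K), I' ≠ ⊥ ∧ ∀ A ∈ Gamma I',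
      (SpecialLinearGroup.map (algebraMap (𝓞 K) K) A)⁻¹ * (1 : SL(2, K)) *
          SpecialLinearGroup.map (algebraMap (𝓞 K) K) A * (1 : SL(2, K))⁻¹ ∈
        (relE I I).map (SpecialLinearGroup.map (algebraMap (𝓞 K) K)) := fun I hI ↦
  ⟨I, hI, fun A _ ↦ by simp⟩

/-- Lemma 2 holds for `diag(t, t⁻¹)`, `t` a unit (with `I' = I²`, as `Γ(I²) ⊆ G(I, I)`).
[cite: Vaserstein1972SL2, Lemma 2 (proof)] -/
theorem lemma2_diagHom (hreal : ∃ w : InfinitePlace K, w.IsReal)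
    (hunit : ∃ v : (𝓞 K)ˣ, ∀ n : ℕ, n ≠ 0 → v ^ n ≠ 1) (t : (𝓞 K)ˣ) :
    ∀ I : Ideal (𝓞 K), I ≠ ⊥ → ∃ I' : Ideal (𝓞 K), I' ≠ ⊥ ∧ ∀ A ∈ Gamma I',
      (SpecialLinearGroup.map (algebraMap (𝓞 K) K) A)⁻¹ * SpecialLinearGroup.map (algebraMap (𝓞 K) K) (diagHom t) *
          SpecialLinearGroup.map (algebraMap (𝓞 K) K) A * (SpecialLinearGroup.map (algebraMap (𝓞 K) K) (diagHom t))⁻¹ ∈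
        (relE I I).map (SpecialLinearGroup.map (algebraMap (𝓞 K) K)) := by
  intro I hI
  refine ⟨I * I, mul_ne_zero hI hI, fun A hA ↦ ?_⟩
  rw [← map_inv, ← map_mul, ← map_mul, ← map_inv, ← map_mul]
  exact Subgroup.mem_map_of_mem _
    (conj_diagHom_mem_relE_of_mem_relG hreal hunit t hI (Gamma_mul_self_le_relG I hA))

/-- Lemma 2 is stable under products (uses Lemma 4 for `h₁`). [cite: Vaserstein1972SL2, Lemma 2 (proof)] -/
theorem lemma2_mul (hreal : ∃ w : InfinitePlace K, w.IsReal)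
    (hunit : ∃ v : (𝓞 K)ˣ, ∀ n : ℕ, n ≠ 0 → v ^ n ≠ 1) {h₁ h₂ : SL(2, K)}
    (hh₁ : ∀ I : Ideal (𝓞 K), I ≠ ⊥ → ∃ I' : Ideal (𝓞 K), I' ≠ ⊥ ∧ ∀ A ∈ Gamma I',
        (SpecialLinearGroup.map (algebraMap (𝓞 K) K) A)⁻¹ * h₁ *
            SpecialLinearGroup.map (algebraMap (𝓞 K) K) A * h₁⁻¹ ∈
          (relE I I).map (SpecialLinearGroup.map (algebraMap (𝓞 K) K)))
    (hh₂ : ∀ I : Ideal (𝓞 K), I ≠ ⊥ → ∃ I' : Ideal (𝓞 K), I' ≠ ⊥ ∧ ∀ A ∈ Gamma I',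
        (SpecialLinearGroup.map (algebraMap (𝓞 K) K) A)⁻¹ * h₂ *
            SpecialLinearGroup.map (algebraMap (𝓞 K) K) A * h₂⁻¹ ∈
          (relE I I).map (SpecialLinearGroup.map (algebraMap (𝓞 K) K))) :
    ∀ I : Ideal (𝓞 K), I ≠ ⊥ → ∃ I' : Ideal (𝓞 K), I' ≠ ⊥ ∧ ∀ A ∈ Gamma I',
      (SpecialLinearGroup.map (algebraMap (𝓞 K) K) A)⁻¹ * (h₁ * h₂) *
          SpecialLinearGroup.map (algebraMap (𝓞 K) K) A * (h₁ * h₂)⁻¹ ∈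
        (relE I I).map (SpecialLinearGroup.map (algebraMap (𝓞 K) K)) := by
  intro I hI
  obtain ⟨I₃, hI₃, h3⟩ := exists_conj_relE_le hreal hunit h₁ hI
  obtain ⟨I₁', hI₁', hA₁⟩ := hh₁ I hI
  obtain ⟨I₂', hI₂', hA₂⟩ := hh₂ I₃ hI₃
  refine ⟨I₁' * I₂', mul_ne_zero hI₁' hI₂', fun A hA ↦ ?_⟩
  set a := SpecialLinearGroup.map (algebraMap (𝓞 K) K) A with ha
  have e : a⁻¹ * (h₁ * h₂) * a * (h₁ * h₂)⁻¹ =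
      (a⁻¹ * h₁ * a * h₁⁻¹) * (h₁ * (a⁻¹ * h₂ * a * h₂⁻¹) * h₁⁻¹) := by group
  rw [e]
  refine mul_mem (hA₁ A (Gamma_mono Ideal.mul_le_right hA)) ?_
  obtain ⟨M, hM, hMeq⟩ := Subgroup.mem_map.1 (hA₂ A (Gamma_mono Ideal.mul_le_left hA))
  obtain ⟨E, hE, hEeq⟩ := h3 M hM
  rw [← hMeq, ← hEeq]
  exact Subgroup.mem_map_of_mem _ hE

/-- Lemma 2 is stable under inverses (uses Lemma 4 for `h⁻¹`). [cite: Vaserstein1972SL2, Lemma 2 (proof)] -/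
theorem lemma2_inv (hreal : ∃ w : InfinitePlace K, w.IsReal)
    (hunit : ∃ v : (𝓞 K)ˣ, ∀ n : ℕ, n ≠ 0 → v ^ n ≠ 1) {h : SL(2, K)}
    (hh : ∀ I : Ideal (𝓞 K), I ≠ ⊥ → ∃ I' : Ideal (𝓞 K), I' ≠ ⊥ ∧ ∀ A ∈ Gamma I',
        (SpecialLinearGroup.map (algebraMap (𝓞 K) K) A)⁻¹ * h *
            SpecialLinearGroup.map (algebraMap (𝓞 K) K) A * h⁻¹ ∈
          (relE I I).map (SpecialLinearGroup.map (algebraMap (𝓞 K) K))) :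
    ∀ I : Ideal (𝓞 K), I ≠ ⊥ → ∃ I' : Ideal (𝓞 K), I' ≠ ⊥ ∧ ∀ A ∈ Gamma I',
      (SpecialLinearGroup.map (algebraMap (𝓞 K) K) A)⁻¹ * h⁻¹ *
          SpecialLinearGroup.map (algebraMap (𝓞 K) K) A * h⁻¹⁻¹ ∈
        (relE I I).map (SpecialLinearGroup.map (algebraMap (𝓞 K) K)) := by
  intro I hI
  obtain ⟨I₃, hI₃, h3⟩ := exists_conj_relE_le hreal hunit h⁻¹ hI
  obtain ⟨I', hI', hA⟩ := hh I₃ hI₃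
  refine ⟨I', hI', fun A hAm ↦ ?_⟩
  set a := SpecialLinearGroup.map (algebraMap (𝓞 K) K) A with ha
  have e : a⁻¹ * h⁻¹ * a * h⁻¹⁻¹ = h⁻¹ * (a⁻¹ * h * a * h⁻¹)⁻¹ * h⁻¹⁻¹ := by group
  rw [e]
  obtain ⟨M, hM, hMeq⟩ := Subgroup.mem_map.1 (hA A hAm)
  obtain ⟨E, hE, hEeq⟩ := h3 M⁻¹ (inv_mem hM)
  rw [← hMeq, ← map_inv, ← hEeq]
  exact Subgroup.mem_map_of_mem _ hE

/-- Lemma 2 is stable under conjugation (uses Lemma 4 for `k` and `k⁻¹ Γ(J') k ⊆ Γ(J)`).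
[cite: Vaserstein1972SL2, Lemma 2 (proof)] -/
theorem lemma2_conj (hreal : ∃ w : InfinitePlace K, w.IsReal)
    (hunit : ∃ v : (𝓞 K)ˣ, ∀ n : ℕ, n ≠ 0 → v ^ n ≠ 1) {h : SL(2, K)}
    (hh : ∀ I : Ideal (𝓞 K), I ≠ ⊥ → ∃ I' : Ideal (𝓞 K), I' ≠ ⊥ ∧ ∀ A ∈ Gamma I',
        (SpecialLinearGroup.map (algebraMap (𝓞 K) K) A)⁻¹ * h *
            SpecialLinearGroup.map (algebraMap (𝓞 K) K) A * h⁻¹ ∈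
          (relE I I).map (SpecialLinearGroup.map (algebraMap (𝓞 K) K)))
    (k : SL(2, K)) :
    ∀ I : Ideal (𝓞 K), I ≠ ⊥ → ∃ I' : Ideal (𝓞 K), I' ≠ ⊥ ∧ ∀ A ∈ Gamma I',
      (SpecialLinearGroup.map (algebraMap (𝓞 K) K) A)⁻¹ * (k * h * k⁻¹) *
          SpecialLinearGroup.map (algebraMap (𝓞 K) K) A * (k * h * k⁻¹)⁻¹ ∈
        (relE I I).map (SpecialLinearGroup.map (algebraMap (𝓞 K) K)) := by
  intro I hI
  obtain ⟨I₃, hI₃, h3⟩ := exists_conj_relE_le hreal hunit k hI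
  obtain ⟨J, hJ, hA⟩ := hh I₃ hI₃
  obtain ⟨J', hJ', -, hΓ⟩ := exists_conj_Gamma k⁻¹ hJ
  refine ⟨J', hJ', fun A hAm ↦ ?_⟩
  obtain ⟨B, hB, hBeq⟩ := hΓ A hAm
  rw [inv_inv] at hBeq
  set a := SpecialLinearGroup.map (algebraMap (𝓞 K) K) A with ha
  set b := SpecialLinearGroup.map (algebraMap (𝓞 K) K) B with hb
  have e : a⁻¹ * (k * h * k⁻¹) * a * (k * h * k⁻¹)⁻¹ =
      k * ((k⁻¹ * a * k)⁻¹ * h * (k⁻¹ * a * k) * h⁻¹) * k⁻¹ := by group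
  rw [e, ← hBeq]
  obtain ⟨M, hM, hMeq⟩ := Subgroup.mem_map.1 (hA B hB)
  obtain ⟨E, hE, hEeq⟩ := h3 M hM
  rw [← hMeq, ← hEeq]
  exact Subgroup.mem_map_of_mem _ hE

/-- **Vaserstein 1972, Lemma 2**, principal-congruence form, for every `h ∈ SL₂(K)`: the `h` for
which it holds form a normal subgroup of `SL₂(K)` containing the non-central `diag(v, v⁻¹)`, `v` a
unit of infinite order, hence everything. [cite: Vaserstein1972SL2, Lemma 2] -/
theorem lemma2 (hreal : ∃ w : InfinitePlace K, w.IsReal)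
    (hunit : ∃ v : (𝓞 K)ˣ, ∀ n : ℕ, n ≠ 0 → v ^ n ≠ 1) (h : SL(2, K)) :
    ∀ I : Ideal (𝓞 K), I ≠ ⊥ → ∃ I' : Ideal (𝓞 K), I' ≠ ⊥ ∧ ∀ A ∈ Gamma I',
      (SpecialLinearGroup.map (algebraMap (𝓞 K) K) A)⁻¹ * h *
          SpecialLinearGroup.map (algebraMap (𝓞 K) K) A * h⁻¹ ∈
        (relE I I).map (SpecialLinearGroup.map (algebraMap (𝓞 K) K)) := by
  -- the subgroup of good `h`
  let S : Subgroup SL(2, K) :=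
    { carrier := {h | ∀ I : Ideal (𝓞 K), I ≠ ⊥ → ∃ I' : Ideal (𝓞 K), I' ≠ ⊥ ∧ ∀ A ∈ Gamma I',
          (SpecialLinearGroup.map (algebraMap (𝓞 K) K) A)⁻¹ * h *
              SpecialLinearGroup.map (algebraMap (𝓞 K) K) A * h⁻¹ ∈
            (relE I I).map (SpecialLinearGroup.map (algebraMap (𝓞 K) K))}
      one_mem' := lemma2_one
      mul_mem' := fun h₁ h₂ ↦ lemma2_mul hreal hunit h₁ h₂
      inv_mem' := fun h ↦ lemma2_inv hreal hunit h }
  haveI : S.Normal := ⟨fun _ hh k ↦ lemma2_conj hreal hunit hh k⟩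
  have h2 : ∃ a : K, a ≠ 0 ∧ a ^ 2 ≠ 1 := ⟨2, two_ne_zero, by norm_num⟩
  rcases normal_le_center_or_eq_top h2 S with hle | htop
  · -- `diag(v, v⁻¹)` with `v` of infinite order satisfies Lemma 2 but is not central
    exfalso
    obtain ⟨v, hv⟩ := id hunit
    have hmem := hle (lemma2_diagHom hreal hunit v : _ ∈ S)
    rw [Subgroup.mem_center_iff] at hmem
    have h01 := congrArg (fun M : SL(2, K) ↦ M 0 1) (hmem (e12 1))
    simp only [mul_apply_two, map_apply_two, diagHom_apply_00, diagHom_apply_01,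
      diagHom_apply_11, e12_apply_00, e12_apply_01, e12_apply_11, map_zero,
      mul_zero, add_zero, one_mul, mul_one, zero_add] at h01
    -- `h01 : algebraMap v⁻¹ = algebraMap v`, so `v² = 1`
    apply hv 2 two_ne_zero
    have h' : ((v⁻¹ : (𝓞 K)ˣ) : 𝓞 K) = v := IsFractionRing.injective (𝓞 K) K h01
    refine Units.ext ?_
    rw [Units.val_pow_eq_pow_val, pow_two, Units.val_one]
    calc (v : 𝓞 K) * v = v * ↑v⁻¹ := by rw [h']
      _ = 1 := v.mul_inv
  · have : h ∈ S := by rw [htop]; exact Subgroup.mem_top h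
    exact this

/-- **Vaserstein 1972, Lemma 2** (= Liehl 1981, (4)): for every ideal `I ≠ 0` of `𝓞 K` and every
`h ∈ SL₂(K)` there is an ideal `0 ≠ I' ⊆ I` with `A⁻¹ h A h⁻¹ ∈ E(I, I)` for all `A ∈ G(I', I')`
(`K` with a real place and a unit of infinite order). [cite: Vaserstein1972SL2, Lemma 2] -/
theorem exists_forall_relG_conj_mem (hreal : ∃ w : InfinitePlace K, w.IsReal)
    (hunit : ∃ v : (𝓞 K)ˣ, ∀ n : ℕ, n ≠ 0 → v ^ n ≠ 1) (h : SL(2, K)) {I : Ideal (𝓞 K)}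
    (hI : I ≠ ⊥) : ∃ I' : Ideal (𝓞 K), I' ≠ ⊥ ∧ I' ≤ I ∧ ∀ A ∈ relG I' I',
      (SpecialLinearGroup.map (algebraMap (𝓞 K) K) A)⁻¹ * h *
          SpecialLinearGroup.map (algebraMap (𝓞 K) K) A * h⁻¹ ∈
        (relE I I).map (SpecialLinearGroup.map (algebraMap (𝓞 K) K)) := by
  obtain ⟨I₃, hI₃, h3⟩ := exists_conj_relE_le hreal hunit h hI
  obtain ⟨I₅, hI₅, h5⟩ := lemma2 hreal hunit h I hI
  set I' : Ideal (𝓞 K) := I₃ * I * I₅ with hI'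
  have hI'0 : I' ≠ ⊥ := mul_ne_zero (mul_ne_zero hI₃ hI) hI₅
  have hI'I : I' ≤ I := Ideal.mul_le_right.trans Ideal.mul_le_left
  have hI'3 : I' ≤ I₃ := Ideal.mul_le_right.trans Ideal.mul_le_right
  have hI'5 : I' ≤ I₅ := Ideal.mul_le_left
  refine ⟨I', hI'0, hI'I, fun A hA ↦ ?_⟩
  -- Lemma 1: `A = C E⁻¹`, `C ∈ Γ(I')`, `E ∈ E(I', I')`
  obtain ⟨E, hE, hC⟩ := exists_mul_relE_mem_Gamma hI'0 le_rfl hA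
  set a := SpecialLinearGroup.map (algebraMap (𝓞 K) K) A with ha
  set c := SpecialLinearGroup.map (algebraMap (𝓞 K) K) (A * E) with hc
  set e := SpecialLinearGroup.map (algebraMap (𝓞 K) K) E with he
  have hae : a = c * e⁻¹ := by rw [hc, map_mul, ← ha, ← he, mul_inv_cancel_right]
  have eq : a⁻¹ * h * a * h⁻¹ = e * (c⁻¹ * h * c * h⁻¹) * (h * e⁻¹ * h⁻¹) := by
    rw [hae]; group
  rw [eq]
  refine mul_mem (mul_mem (Subgroup.mem_map_of_mem _ (relE_mono hI'I hI'I hE)) ?_) ?_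
  · exact h5 (A * E) (Gamma_mono hI'5 hC)
  · obtain ⟨E', hE', hEq'⟩ := h3 E⁻¹ (relE_mono hI'3 hI'3 (inv_mem hE))
    rw [he, ← map_inv, ← hEq']
    exact Subgroup.mem_map_of_mem _ hE'

/-- **`E(I₁, I₂)` is normalised by `G(I₁, I₂)`** (Vaserstein p. 314, from Lemmas 1 and 2; = Liehl
1981, (5)), for non-zero ideals of the integers of a number field with a real place and a unit of
infinite order. [cite: Vaserstein1972SL2, p. 314] -/
theorem conj_mem_relE_of_mem_relG (hreal : ∃ w : InfinitePlace K, w.IsReal)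
    (hunit : ∃ v : (𝓞 K)ˣ, ∀ n : ℕ, n ≠ 0 → v ^ n ≠ 1) {I₁ I₂ : Ideal (𝓞 K)} (hI₁ : I₁ ≠ ⊥)
    (hI₂ : I₂ ≠ ⊥) {A : SL(2, 𝓞 K)} (hA : A ∈ relG I₁ I₂) {M : SL(2, 𝓞 K)}
    (hM : M ∈ relE I₁ I₂) : A⁻¹ * M * A ∈ relE I₁ I₂ := by
  have hinj := map_injective (algebraMap (𝓞 K) K) (IsFractionRing.injective (𝓞 K) K)
  set I : Ideal (𝓞 K) := I₁ * I₂ with hIdef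
  have hI : I ≠ ⊥ := mul_ne_zero hI₁ hI₂
  have hEI : relE I I ≤ relE I₁ I₂ := relE_mono Ideal.mul_le_right Ideal.mul_le_left
  -- conjugates of the generators
  have hgen : ∀ g ∈ relE I₁ I₂, (∀ B : SL(2, 𝓞 K), B⁻¹ * g * B = B⁻¹ * g * B) →
      ∀ I' : Ideal (𝓞 K), I' ≠ ⊥ → I' ≤ I →
      (∀ B ∈ relG I' I', (SpecialLinearGroup.map (algebraMap (𝓞 K) K) B)⁻¹ *
          SpecialLinearGroup.map (algebraMap (𝓞 K) K) g *
          SpecialLinearGroup.map (algebraMap (𝓞 K) K) B *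
          (SpecialLinearGroup.map (algebraMap (𝓞 K) K) g)⁻¹ ∈
        (relE I I).map (SpecialLinearGroup.map (algebraMap (𝓞 K) K))) →
      A⁻¹ * g * A ∈ relE I₁ I₂ := by
    intro g hg _ I' hI' hI'I hB
    -- Lemma 1: `B = AE ∈ G(I', I')`
    obtain ⟨E, hE, hBm⟩ := exists_mul_relE_mem_relG hI' (hI'I.trans Ideal.mul_le_right) hA
    obtain ⟨N, hN, hNeq⟩ := Subgroup.mem_map.1 (hB (A * E) hBm)
    rw [← map_inv, ← map_mul, ← map_mul, ← map_inv, ← map_mul] at hNeq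
    have hN' : (A * E)⁻¹ * g * (A * E) * g⁻¹ ∈ relE I₁ I₂ := by rw [← hinj hNeq]; exact hEI hN
    have e : A⁻¹ * g * A = E * ((A * E)⁻¹ * g * (A * E) * g⁻¹) * g * E⁻¹ := by group
    rw [e]
    exact mul_mem (mul_mem (mul_mem hE hN') hg) (inv_mem hE)
  -- closure induction
  refine Subgroup.closure_induction (p := fun M _ ↦ A⁻¹ * M * A ∈ relE I₁ I₂) ?_ ?_ ?_ ?_ hM
  · rintro g (⟨x, hx, rfl⟩ | ⟨y, hy, rfl⟩)
    · obtain ⟨I', hI', hI'I, hB⟩ := exists_forall_relG_conj_mem hreal hunit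
        (SpecialLinearGroup.map (algebraMap (𝓞 K) K) (e12 x)) hI
      exact hgen (e12 x) (e12_mem_relE hx) (fun _ ↦ rfl) I' hI' hI'I hB
    · obtain ⟨I', hI', hI'I, hB⟩ := exists_forall_relG_conj_mem hreal hunit
        (SpecialLinearGroup.map (algebraMap (𝓞 K) K) (e21 y)) hI
      exact hgen (e21 y) (e21_mem_relE hy) (fun _ ↦ rfl) I' hI' hI'I hB
  · simp
  · intro M N _ _ hM hN
    have e : A⁻¹ * (M * N) * A = (A⁻¹ * M * A) * (A⁻¹ * N * A) := by group
    rw [e]; exact mul_mem hM hN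
  · intro M _ hM
    have e : A⁻¹ * M⁻¹ * A = (A⁻¹ * M * A)⁻¹ := by group
    rw [e]; exact inv_mem hM

/-- The same with `A M A⁻¹`. [cite: Vaserstein1972SL2, p. 314] -/
theorem conj_mem_relE_of_mem_relG' (hreal : ∃ w : InfinitePlace K, w.IsReal)
    (hunit : ∃ v : (𝓞 K)ˣ, ∀ n : ℕ, n ≠ 0 → v ^ n ≠ 1) {I₁ I₂ : Ideal (𝓞 K)} (hI₁ : I₁ ≠ ⊥)
    (hI₂ : I₂ ≠ ⊥) {A : SL(2, 𝓞 K)} (hA : A ∈ relG I₁ I₂) {M : SL(2, 𝓞 K)}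
    (hM : M ∈ relE I₁ I₂) : A * M * A⁻¹ ∈ relE I₁ I₂ := by
  simpa using conj_mem_relE_of_mem_relG hreal hunit hI₁ hI₂ (inv_mem hA) hM

/-- `E(I₁, I₂)` as a subgroup of `G(I₁, I₂)` is normal. [cite: Vaserstein1972SL2, p. 314] -/
theorem relE_subgroupOf_relG_normal (hreal : ∃ w : InfinitePlace K, w.IsReal)
    (hunit : ∃ v : (𝓞 K)ˣ, ∀ n : ℕ, n ≠ 0 → v ^ n ≠ 1) {I₁ I₂ : Ideal (𝓞 K)} (hI₁ : I₁ ≠ ⊥)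
    (hI₂ : I₂ ≠ ⊥) : ((relE I₁ I₂).subgroupOf (relG I₁ I₂)).Normal := by
  refine ⟨fun M hM A ↦ ?_⟩
  rw [Subgroup.mem_subgroupOf] at hM ⊢
  simpa using conj_mem_relE_of_mem_relG' hreal hunit hI₁ hI₂ A.prop hM

end NumberField

end SL2Rel

end Literature.NumberTheory.Automorphic
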